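import Mathlib

/-!
# Monomial count of a polynomial of bounded total degree

A crude bound on the number of monomials of an `n`-variable polynomial of total
degree at most `d`: every exponent vector `s` in the support satisfies `s i ≤ d`
for each variable `i`, so the support injects into `Fin n → Fin (d + 1)`, a type
of cardinality `(d + 1) ^ n`.
-/

set_option linter.dupNamespace false

namespace Summit.MatrixMultiplication.MatrixMultiplication.Theorems.BorderHalfDimensionDesigns

/-- Each exponent of a monomial in the support of `R` is bounded by the total degree of `R`. -/
private theorem apply_le_totalDegree_of_mem_support {σ S : Type*} [CommSemiring S]
    {R : MvPolynomial σ S} {s : σ →₀ ℕ} (hs : s ∈ R.support) (i : σ) :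
    s i ≤ R.totalDegree :=
  (Finsupp.le_degree i s).trans (MvPolynomial.le_totalDegree hs)

/-- A polynomial in `n` variables of total degree at most `d` has at most `(d + 1) ^ n`
monomials in its support: the exponent vectors inject into `Fin n → Fin (d + 1)`. -/
theorem stub_card_support_le {n d : ℕ} (R : MvPolynomial (Fin n) ℂ) (hR : R.totalDegree ≤ d) :
    R.support.card ≤ (d + 1) ^ n := by
  classical
  -- every exponent of a support monomial is at most `d`
  have hle : ∀ s ∈ R.support, ∀ i, s i ≤ d := fun s hs i =>
    (apply_le_totalDegree_of_mem_support hs i).trans hR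
  -- truncated exponent map into the box `Fin n → Fin (d + 1)`
  let f : (Fin n →₀ ℕ) → (Fin n → Fin (d + 1)) := fun s i => ⟨min (s i) d, by omega⟩
  have hinj : Set.InjOn f R.support := by
    intro s hs t ht hst
    ext i
    have h := congrArg (fun g : Fin n → Fin (d + 1) => ((g i : Fin (d + 1)) : ℕ)) hst
    have hs' := hle s hs i
    have ht' := hle t ht i
    simp only [f] at h
    omega
  calc R.support.card ≤ (Finset.univ : Finset (Fin n → Fin (d + 1))).card :=
        Finset.card_le_card_of_injOn f (fun _ _ => Finset.mem_coe.2 (Finset.mem_univ _)) hinj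
    _ = (d + 1) ^ n := by simp
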